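import Literature.Analysis.FluidPDE.PassiveVectorTensorSpaceTimePairing
import Literature.Analysis.FluidPDE.PassiveVectorTensorModeEnergy
import Literature.Analysis.FluidPDE.PassiveScalarForcedTrace
import Literature.Analysis.FluidPDE.PassiveScalarReleasePairing
import HarnessLib

/-!
# Weak tensor-viscosity passive-vector solutions: RESTART at an intermediate time from a trace datum
# (time translation / evolution property)

Analysis/FluidPDE proof-support file (everything proved; no definitions, no named facts).  A weak solution `w` of
`∂ₜw + (b·∇)w + A (w·∇)b + ∇π = 𝓛_𝔸 w`, `∇·w = 0` on `T^d × [0,T)` from `w₀` (class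
`Torus.IsWeakTensorPassiveVectorOn A T 𝔸 b w₀ w`, determined for a.e. `t` only), a time `0 ≤ σ < T`, and a field `wσ`
satisfying the TRACE IDENTITIES at `σ` — for every smooth divergence-free steady `G`,
`∫⟪wσ, G⟫ = ∫⟪w₀, G⟫ + ∫_{(0,σ]} (∫⟪w(τ), (b(τ)·∇)G + 𝓛_𝔸^*G⟫ + A∫⟪b(τ), (w(τ)·∇)G⟫) dτ`
(which hold with `wσ = w(σ)` for a.e. `σ`, `PassiveVectorTensorClass.ae_integral_inner_eq`) — give: the translate
`t ↦ w(σ + t)` is a weak solution on `T^d × [0, T − σ)` along `b(σ + ·)` with the same tensor and coupling, from the datum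
`wσ` (`IsWeakTensorPassiveVectorOn.translate_time`).  This is the evolution (restart / semigroup) property of the linear
problem (DiPerna–Lions 1989, §II.1 (12)–(14) and §II.3; Pazy 1983, §5.1) in the a.e. language of the class; the proof tests
the original problem with the shifted test field, splits the time integral at `σ`, and identifies the boundary term through the
absolutely continuous representatives of the space–time pairing (`PassiveVectorTensorSpaceTimePairing.ae_integral_inner_spaceTime_eq`)
and of the steady pairing (`ae_integral_inner_eq`), which agree at `σ` by continuity.  Port of the scalar
`PassiveScalarDiagForcedRestart.translate`.  Consumer: window-by-window bookkeeping of the K1L one-level lemma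
(`stub_oneLevelL_IW`, route `SolenoidalFractalHomogenisation`, cell `ad-ideate`): restart of the cell / effective problems at
refresh and sub-window times.

## References

* R. J. DiPerna, P.-L. Lions, *Ordinary differential equations, transport theory and Sobolev spaces*, Invent. Math. 98
  (1989), §II.1 (12)–(14), §II.3. [`DiPernaLions1989`]
* A. Pazy, *Semigroups of Linear Operators and Applications to PDE* (Springer 1983), Ch. 5 §5.1. [`Pazy1983`]
-/

noncomputable section

open MeasureTheory Set Filter Function TopologicalSpace
open scoped ENNReal NNReal InnerProductSpace ContDiff

namespace Literature.Analysis.FluidPDE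

namespace Torus

variable {d : Type*} [Fintype d] [DecidableEq d]

/-! ## Time shifts `t ↦ σ + t`: measure preservation and transfer lemmas -/

section Shift

omit [Fintype d] [DecidableEq d] in
/-- `t ↦ σ + t` maps Lebesgue measure on `(0,T')` to Lebesgue measure on `(σ, σ + T')`. [cite: DiPernaLions1989, §II.1 (12)–(14)] -/
theorem measurePreserving_time_shift (σ T' : ℝ) :
    MeasurePreserving (fun t : ℝ => σ + t) ((volume : Measure ℝ).restrict (Ioo 0 T'))
      ((volume : Measure ℝ).restrict (Ioo σ (σ + T'))) := by
  have h := (measurePreserving_add_left (volume : Measure ℝ) σ).restrict_preimage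
    (measurableSet_Ioo (a := σ) (b := σ + T'))
  have hpre : (fun t : ℝ => σ + t) ⁻¹' Ioo σ (σ + T') = Ioo 0 T' := by
    ext t; simp
  rwa [hpre] at h

omit [Fintype d] [DecidableEq d] in
/-- Integrability on `(0,T)` passes to the shift on `(0,T')` when `(σ, σ+T') ⊆ (0,T)`. [cite: DiPernaLions1989, §II.1 (12)–(14)] -/
theorem integrableOn_time_shift {E : Type*} [NormedAddCommGroup E] {F : ℝ → E} {T σ T' : ℝ}
    (h : IntegrableOn F (Ioo 0 T) volume) (hσ : 0 ≤ σ) (hT' : σ + T' ≤ T) :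
    IntegrableOn (fun t => F (σ + t)) (Ioo 0 T') volume := by
  have hme : MeasurableEmbedding (fun t : ℝ => σ + t) := (MeasurableEquiv.addLeft σ).measurableEmbedding
  have hpre : (fun t : ℝ => σ + t) ⁻¹' Ioo σ (σ + T') = Ioo 0 T' := by
    ext t; simp
  have := ((measurePreserving_add_left (volume : Measure ℝ) σ).integrableOn_comp_preimage hme
    (f := F) (s := Ioo σ (σ + T'))).2 (h.mono_set (Ioo_subset_Ioo hσ hT'))
  rwa [hpre] at this

omit [Fintype d] [DecidableEq d] in
/-- Change of variables `t = σ + τ` in a Bochner integral over a shifted window. [cite: DiPernaLions1989, §II.1 (12)–(14)] -/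
theorem setIntegral_time_shift {E : Type*} [NormedAddCommGroup E] [NormedSpace ℝ E] (F : ℝ → E) (σ T' : ℝ) :
    ∫ t in Ioo 0 T', F (σ + t) = ∫ t in Ioo σ (σ + T'), F t :=
  (measurePreserving_time_shift σ T').integral_comp (MeasurableEquiv.addLeft σ).measurableEmbedding F

end Shift

/-! ## Tools: a.e. versus everywhere for continuous functions; shifted test fields -/

section Tools

omit [Fintype d] [DecidableEq d] in
/-- A function continuous on `[0,T]` which is `≤ M` for a.e. `t ∈ (0,T)` is `≤ M` on `[0,T]` (`T > 0`).
[cite: DiPernaLions1989, §II.1 (12)–(14)] -/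
theorem le_on_Icc_of_ae_le_of_continuousOn {T : ℝ} (hT : 0 < T) {f : ℝ → ℝ} {M : ℝ}
    (hf : ContinuousOn f (Icc 0 T)) (h : ∀ᵐ t ∂(volume.restrict (Ioo 0 T)), f t ≤ M) :
    ∀ t ∈ Icc 0 T, f t ≤ M := by
  have hae : ∀ᵐ t ∂(volume.restrict (Icc 0 T)), (fun t => max (f t) M) t = (fun _ => M) t := by
    have e : (volume : Measure ℝ).restrict (Icc 0 T) = volume.restrict (Ioo 0 T) :=
      Measure.restrict_congr_set Ioo_ae_eq_Icc.symm
    rw [e]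
    filter_upwards [h] with t ht
    exact max_eq_right ht
  have key := Measure.eqOn_Icc_of_ae_eq (μ := volume) hT.ne hae (hf.sup continuousOn_const)
    continuousOn_const
  intro t ht
  have h1 : max (f t) M = M := key ht
  exact (le_max_left _ _).trans h1.le

variable {T σ : ℝ} {Ψ : ℝ → UnitAddTorus d → EuclideanSpace ℝ d}

omit [DecidableEq d] in
/-- A test field on `[0, T − σ)` shifted forward by `σ` is a test field on `[0,T)`. [cite: DiPernaLions1989, §II.1 (12)–(14)] -/
theorem isSpaceTimeTest_time_shift (hΨ : FunctionSpaces.Torus.IsSpaceTimeTest (T - σ) Ψ) :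
    FunctionSpaces.Torus.IsSpaceTimeTest T (fun t x => Ψ (t - σ) x) := by
  obtain ⟨hs, T₁, hT₁, h0⟩ := hΨ
  refine ⟨?_, T₁ + σ, by linarith, fun t ht => ?_⟩
  · have e : FunctionSpaces.Torus.stLift (fun t x => Ψ (t - σ) x) =
        FunctionSpaces.Torus.stLift Ψ ∘ fun p : ℝ × EuclideanSpace ℝ d => (p.1 - σ, p.2) := by
      funext p; rfl
    rw [e]
    exact hs.comp ((contDiff_fst.sub contDiff_const).prodMk contDiff_snd)
  · show Ψ (t - σ) = 0
    exact h0 _ (by linarith)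

omit [DecidableEq d] in
/-- Time derivative of the shifted test field: `∂ₜ(Ψ(· − σ))(t) = (∂ₜΨ)(t − σ)`. [cite: DiPernaLions1989, §II.1 (12)–(14)] -/
theorem timeDeriv_time_shift (Ψ : ℝ → UnitAddTorus d → EuclideanSpace ℝ d) (σ t : ℝ) (x : UnitAddTorus d) :
    FunctionSpaces.Torus.timeDeriv (fun t x => Ψ (t - σ) x) t x = FunctionSpaces.Torus.timeDeriv Ψ (t - σ) x := by
  simp only [FunctionSpaces.Torus.timeDeriv]
  exact deriv_comp_sub_const (fun τ => Ψ τ x) σ t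

omit [DecidableEq d] in
/-- **Lipschitz dependence in time** of a space–time test field on `[0,T']`: `‖Ψ(t, x) − Ψ(t₀, x)‖ ≤ L |t − t₀|` with
`L = sup_{[0,T'] × T^d} ‖∂ₜΨ‖` (mean value inequality). [cite: DiPernaLions1989, §II.1 (12)–(14)] -/
theorem exists_lipschitz_time_of_isSpaceTimeTest {T' : ℝ} (hΨ : FunctionSpaces.Torus.IsSpaceTimeTest T Ψ) :
    ∃ L : ℝ, 0 ≤ L ∧ ∀ t ∈ Icc 0 T', ∀ t₀ ∈ Icc 0 T', ∀ x, ‖Ψ t x - Ψ t₀ x‖ ≤ L * |t - t₀| := by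
  obtain ⟨L, hL⟩ := hΨ.exists_bound_timeDeriv (isCompact_Icc (a := 0) (b := T'))
  refine ⟨max L 0, le_max_right _ _, fun t ht t₀ ht₀ x => ?_⟩
  have h := Convex.norm_image_sub_le_of_norm_deriv_le (f := fun τ => Ψ τ x) (s := Icc 0 T')
    (fun τ _ => (IsSpaceTimeTest.hasDerivAt_slice hΨ x τ).differentiableAt)
    (fun τ hτ => by
      rw [(IsSpaceTimeTest.hasDerivAt_slice hΨ x τ).deriv]
      exact (hL τ hτ x).trans (le_max_left L 0))
    (convex_Icc 0 T') ht₀ ht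
  rw [Real.norm_eq_abs] at h
  exact h

end Tools

namespace IsWeakTensorPassiveVectorOn

variable {A T : ℝ} {𝔸 : Visc4 d} {b w : ℝ → UnitAddTorus d → EuclideanSpace ℝ d}
  {w₀ wσ : UnitAddTorus d → EuclideanSpace ℝ d}

/-! ## Restart from a trace datum -/

/-- **Restart at an intermediate time from the trace (time translation).**  Let `w` be a weak tensor-viscosity passive-vector
solution on `T^d × [0,T)` from `w₀`, let `0 ≤ σ < T`, and let `wσ` satisfy the trace identities at `σ`: for every smooth
divergence-free steady `G`,
`∫⟪wσ, G⟫ = ∫⟪w₀, G⟫ + ∫_{(0,σ]} (∫⟪w(τ), (b(τ)·∇)G + 𝓛_𝔸^*G⟫ + A∫⟪b(τ), (w(τ)·∇)G⟫) dτ`.  Then the translate `t ↦ w(σ + t)`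
is a weak solution on `T^d × [0, T − σ)` along the carrier `b(σ + ·)` with the same tensor and coupling, from the datum `wσ`
(the evolution / semigroup property of the linear problem).
[cite: DiPernaLions1989, §II.1 (12)–(14)] [cite: Pazy1983, Ch. 5 §5.1] -/
theorem translate_time (h : IsWeakTensorPassiveVectorOn A T 𝔸 b w₀ w) {σ : ℝ} (hσ : 0 ≤ σ) (hσT : σ < T)
    (htr : ∀ G : UnitAddTorus d → EuclideanSpace ℝ d, FunctionSpaces.Torus.IsSmooth G → FunctionSpaces.Torus.IsDivFree G →
      ∫ x, ⟪wσ x, G x⟫_ℝ = (∫ x, ⟪w₀ x, G x⟫_ℝ) +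
        ∫ τ in Ioc 0 σ, ((∫ x, ⟪w τ x, FunctionSpaces.Torus.convect (b τ) G x + viscAdj 𝔸 G x⟫_ℝ) +
          A * ∫ x, ⟪b τ x, FunctionSpaces.Torus.convect (w τ) G x⟫_ℝ)) :
    IsWeakTensorPassiveVectorOn A (T - σ) 𝔸 (fun t => b (σ + t)) wσ (fun t => w (σ + t)) := by
  have hTT : σ + (T - σ) ≤ T := by linarith
  have hT : 0 < T := hσ.trans_lt hσT
  obtain ⟨C, hC⟩ := h.ae_lintegral_sq_le
  refine ⟨?_, ?_, ⟨C, ae_restrict_Ioo_comp_add_left hC hσ hTT⟩, ?_, ?_, ae_restrict_Ioo_comp_add_left h.ae_isWeaklyDivFree_carrier hσ hTT,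
    ae_restrict_Ioo_comp_add_left h.ae_isWeaklyDivFree hσ hTT, ?_⟩
  · exact FunctionSpaces.Torus.aestronglyMeasurable_stLift_of_uncurry
      (aestronglyMeasurable_uncurry_comp_add_left h.aestronglyMeasurable_uncurry hσ hTT)
  · exact FunctionSpaces.Torus.aestronglyMeasurable_stLift_of_uncurry
      (aestronglyMeasurable_uncurry_comp_add_left h.aestronglyMeasurable_uncurry_carrier hσ hTT)
  · exact (setLIntegral_comp_add_left_le (F := fun t => (∫⁻ x, ‖b t x‖ₑ ^ 2) ^ (1 / 2 : ℝ)) hσ hTT).trans_lt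
      h.lintegral_carrier_lt_top
  · exact (setLIntegral_comp_add_left_le (F := fun t => ∫⁻ x, ‖b t x‖ₑ * ‖w t x‖ₑ) hσ hTT).trans_lt
      h.lintegral_mul_lt_top
  -- the weak formulation
  intro Ψ hΨ hΨdiv
  -- the shifted test field on `[0,T)` and its weak integrand
  set Ψσ : ℝ → UnitAddTorus d → EuclideanSpace ℝ d := fun t x => Ψ (t - σ) x with hΨσ_def
  have hΨσ : FunctionSpaces.Torus.IsSpaceTimeTest T Ψσ := isSpaceTimeTest_time_shift hΨ
  have hΨσdiv : ∀ t, FunctionSpaces.Torus.IsDivFree (Ψσ t) := fun t => hΨdiv (t - σ)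
  have hΨσ_shift : ∀ t, Ψσ (σ + t) = Ψ t := fun t => by
    funext x; simp only [hΨσ_def, add_sub_cancel_left]
  have hΨσ_σ : Ψσ σ = Ψ 0 := by
    have := hΨσ_shift 0; rwa [add_zero] at this
  -- the weak integrand of the shifted test, as a function of time
  set Aw : ℝ → ℝ := fun t => ∫ x, (⟪w t x, FunctionSpaces.Torus.timeDeriv Ψσ t x +
      FunctionSpaces.Torus.convect (b t) (Ψσ t) x + viscAdj 𝔸 (Ψσ t) x⟫_ℝ +
    A * ⟪b t x, FunctionSpaces.Torus.convect (w t) (Ψσ t) x⟫_ℝ) with hAw_def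
  have hAw_shift : ∀ t, Aw (σ + t) = ∫ x, (⟪w (σ + t) x, FunctionSpaces.Torus.timeDeriv Ψ t x +
      FunctionSpaces.Torus.convect (b (σ + t)) (Ψ t) x + viscAdj 𝔸 (Ψ t) x⟫_ℝ +
    A * ⟪b (σ + t) x, FunctionSpaces.Torus.convect (w (σ + t)) (Ψ t) x⟫_ℝ) := by
    intro t
    simp only [hAw_def, hΨσ_shift t]
    refine integral_congr_ae (Eventually.of_forall fun x => ?_)
    have e : FunctionSpaces.Torus.timeDeriv Ψσ (σ + t) x = FunctionSpaces.Torus.timeDeriv Ψ t x := by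
      rw [hΨσ_def, timeDeriv_time_shift, add_sub_cancel_left]
    simp only [e]
  have hAint : IntegrableOn Aw (Ioo 0 T) volume := (h.integrable_weakIntegrand hΨσ).integral_prod_left
  -- (1) the weak formulation of `w` tested with `Ψσ`
  have hweak : (∫ t in Ioo 0 T, Aw t) + ∫ x, ⟪w₀ x, Ψσ 0 x⟫_ℝ = 0 := h.weak_eq Ψσ hΨσ hΨσdiv
  -- (2) splitting the time integral at `σ`
  have hsplit : ∫ t in Ioo 0 T, Aw t = (∫ t in Ioc 0 σ, Aw t) + ∫ t in Ioo σ T, Aw t := by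
    have hF' : IntegrableOn Aw (Ioc 0 T) volume := hAint.congr_set_ae Ioo_ae_eq_Ioc.symm
    have h1 : IntervalIntegrable Aw volume 0 σ :=
      (intervalIntegrable_iff_integrableOn_Ioc_of_le hσ).2 (hF'.mono_set (Ioc_subset_Ioc_right hσT.le))
    have h2 : IntervalIntegrable Aw volume σ T :=
      (intervalIntegrable_iff_integrableOn_Ioc_of_le hσT.le).2 (hF'.mono_set (Ioc_subset_Ioc_left hσ))
    rw [← integral_Ioc_eq_integral_Ioo (x := (0 : ℝ)) (y := T), ← integral_Ioc_eq_integral_Ioo (x := σ) (y := T),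
      ← intervalIntegral.integral_of_le hT.le, ← intervalIntegral.integral_of_le hσ,
      ← intervalIntegral.integral_of_le hσT.le]
    exact (intervalIntegral.integral_add_adjacent_intervals h1 h2).symm
  -- (3) the absolutely continuous representatives: `Q` of `t ↦ ∫⟪w(t), Ψσ(t)⟫`, `P` of `t ↦ ∫⟪w(t), Ψ 0⟫`
  set Q : ℝ → ℝ := fun t => (∫ x, ⟪w₀ x, Ψσ 0 x⟫_ℝ) + ∫ τ in Ioc 0 t, Aw τ with hQ_def
  have hG : FunctionSpaces.Torus.IsSmooth (Ψ 0) := hΨ.isSmooth_slice 0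
  have hGdiv : FunctionSpaces.Torus.IsDivFree (Ψ 0) := hΨdiv 0
  set Fst : ℝ → ℝ := fun τ => (∫ x, ⟪w τ x, FunctionSpaces.Torus.convect (b τ) (Ψ 0) x + viscAdj 𝔸 (Ψ 0) x⟫_ℝ) +
      A * ∫ x, ⟪b τ x, FunctionSpaces.Torus.convect (w τ) (Ψ 0) x⟫_ℝ with hFst_def
  have hFst : IntegrableOn Fst (Ioo 0 T) volume := h.integrableOn_steadyRHS hG
  set P : ℝ → ℝ := fun t => (∫ x, ⟪w₀ x, Ψ 0 x⟫_ℝ) + ∫ τ in Ioc 0 t, Fst τ with hP_def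
  have hQc : ContinuousOn Q (Icc 0 T) :=
    continuousOn_const.add (intervalIntegral.continuousOn_primitive (hAint.congr_set_ae Ioo_ae_eq_Icc.symm))
  have hPc : ContinuousOn P (Icc 0 T) :=
    continuousOn_const.add (intervalIntegral.continuousOn_primitive (hFst.congr_set_ae Ioo_ae_eq_Icc.symm))
  have hQae : ∀ᵐ t ∂(volume.restrict (Ioo 0 T)), ∫ x, ⟪w t x, Ψσ t x⟫_ℝ = Q t := by
    filter_upwards [h.ae_integral_inner_spaceTime_eq hΨσ hΨσdiv] with t ht
    simpa only [hQ_def, hAw_def] using ht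
  have hPae : ∀ᵐ t ∂(volume.restrict (Ioo 0 T)), ∫ x, ⟪w t x, Ψ 0 x⟫_ℝ = P t := by
    filter_upwards [h.ae_integral_inner_eq hG hGdiv] with t ht
    simpa only [hP_def, hFst_def] using ht
  -- (4) `Q σ = P σ`: the continuous function `|Q − P| − C₁ L |· − σ|` is `≤ 0` a.e., hence at `σ`
  obtain ⟨L, hL0, hL⟩ := exists_lipschitz_time_of_isSpaceTimeTest (T' := T) hΨσ
  obtain ⟨C₁, hC₁⟩ := h.exists_eLpNorm_le
  have hGc : Continuous (Ψ 0) := hG.continuous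
  have hbound : ∀ᵐ t ∂(volume.restrict (Ioo 0 T)), |Q t - P t| - (C₁ : ℝ) * L * |t - σ| ≤ 0 := by
    filter_upwards [hQae, hPae, h.ae_integrable_slice, hC₁, h.ae_memLp_two, ae_restrict_mem measurableSet_Ioo]
      with t htQ htP hti ht₁ htm htI
    obtain ⟨hwi, -, -⟩ := hti
    have htIcc : t ∈ Icc 0 T := Ioo_subset_Icc_self htI
    have hσIcc : σ ∈ Icc 0 T := ⟨hσ, hσT.le⟩
    have hΨc : Continuous (Ψσ t) := (hΨσ.isSmooth_slice t).continuous
    have i1 : Integrable (fun x => ⟪w t x, Ψσ t x⟫_ℝ) volume := FunctionSpaces.Torus.integrable_inner_of_continuous hwi hΨc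
    have i2 : Integrable (fun x => ⟪w t x, Ψ 0 x⟫_ℝ) volume := FunctionSpaces.Torus.integrable_inner_of_continuous hwi hGc
    have hdiff : Q t - P t = ∫ x, ⟪w t x, Ψσ t x - Ψ 0 x⟫_ℝ := by
      rw [← htQ, ← htP, ← integral_sub i1 i2]
      exact integral_congr_ae (Eventually.of_forall fun x => by simp only [inner_sub_right])
    -- `∫ ‖w t‖ ≤ C₁`
    have hL1 : ∫ x, ‖w t x‖ ≤ (C₁ : ℝ) := by
      have e1 : ∫ x, ‖w t x‖ = (∫⁻ x, ‖w t x‖ₑ).toReal := by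
        rw [← integral_norm_eq_lintegral_enorm hwi.aestronglyMeasurable]
      have e2 : ∫⁻ x, ‖w t x‖ₑ = eLpNorm (w t) 1 volume := by rw [eLpNorm_one_eq_lintegral_enorm]
      rw [e1, e2]
      have h12 : eLpNorm (w t) 1 volume ≤ C₁ :=
        (eLpNorm_le_eLpNorm_of_exponent_le (by norm_num) htm.1).trans ht₁
      have := ENNReal.toReal_mono ENNReal.coe_ne_top h12
      simpa using this
    have hpt : ∀ x, ‖⟪w t x, Ψσ t x - Ψ 0 x⟫_ℝ‖ ≤ L * |t - σ| * ‖w t x‖ := by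
      intro x
      refine (norm_inner_le_norm _ _).trans ?_
      rw [mul_comm]
      refine mul_le_mul_of_nonneg_right ?_ (norm_nonneg _)
      have := hL t htIcc σ hσIcc x
      rwa [hΨσ_σ] at this
    have hest : |Q t - P t| ≤ (C₁ : ℝ) * L * |t - σ| := by
      rw [hdiff, ← Real.norm_eq_abs]
      calc ‖∫ x, ⟪w t x, Ψσ t x - Ψ 0 x⟫_ℝ‖ ≤ ∫ x, ‖⟪w t x, Ψσ t x - Ψ 0 x⟫_ℝ‖ := norm_integral_le_integral_norm _
        _ ≤ ∫ x, L * |t - σ| * ‖w t x‖ :=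
            integral_mono_of_nonneg (Eventually.of_forall fun x => norm_nonneg _)
              (hwi.norm.const_mul _) (Eventually.of_forall hpt)
        _ = L * |t - σ| * ∫ x, ‖w t x‖ := integral_const_mul _ _
        _ ≤ L * |t - σ| * C₁ := mul_le_mul_of_nonneg_left hL1 (by positivity)
        _ = (C₁ : ℝ) * L * |t - σ| := by ring
    linarith
  have hcont : ContinuousOn (fun t => |Q t - P t| - (C₁ : ℝ) * L * |t - σ|) (Icc 0 T) :=
    ((hQc.sub hPc).abs).sub (continuousOn_const.mul ((continuousOn_id.sub continuousOn_const).abs))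
  have hQP : Q σ = P σ := by
    have h0 := le_on_Icc_of_ae_le_of_continuousOn hT hcont hbound σ ⟨hσ, hσT.le⟩
    simp only [sub_self, abs_zero, mul_zero, sub_zero] at h0
    have : |Q σ - P σ| = 0 := le_antisymm h0 (abs_nonneg _)
    rwa [abs_eq_zero, sub_eq_zero] at this
  -- (5) the trace identity: `P σ = ∫⟪wσ, Ψ 0⟫`
  have hPσ : P σ = ∫ x, ⟪wσ x, Ψ 0 x⟫_ℝ := by
    rw [htr (Ψ 0) hG hGdiv]
  -- (6) assembling: `∫_{(σ,T)} Aw = −Q σ`, then change variables `t = σ + τ`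
  have hIσT : ∫ t in Ioo σ T, Aw t = -∫ x, ⟪wσ x, Ψ 0 x⟫_ℝ := by
    have e : Q σ = (∫ x, ⟪w₀ x, Ψσ 0 x⟫_ℝ) + ∫ τ in Ioc 0 σ, Aw τ := rfl
    rw [← hPσ, ← hQP]
    linarith [hweak, hsplit, e]
  have hAσ : IntegrableOn (fun t => Aw (σ + t)) (Ioo 0 (T - σ)) volume := integrableOn_time_shift hAint hσ hTT
  have hcv : ∫ t in Ioo 0 (T - σ), Aw (σ + t) = ∫ t in Ioo σ T, Aw t := by
    have := setIntegral_time_shift Aw σ (T - σ)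
    rwa [add_sub_cancel] at this
  have hAe : ∫ t in Ioo 0 (T - σ), Aw (σ + t) =
      ∫ t in Ioo 0 (T - σ), ∫ x, (⟪w (σ + t) x, FunctionSpaces.Torus.timeDeriv Ψ t x +
          FunctionSpaces.Torus.convect (b (σ + t)) (Ψ t) x + viscAdj 𝔸 (Ψ t) x⟫_ℝ +
        A * ⟪b (σ + t) x, FunctionSpaces.Torus.convect (w (σ + t)) (Ψ t) x⟫_ℝ) :=
    setIntegral_congr_fun measurableSet_Ioo fun t _ => hAw_shift t
  rw [← hAe, hcv, hIσT]
  ring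

end IsWeakTensorPassiveVectorOn

end Torus

end Literature.Analysis.FluidPDE

end
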